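import Mathlib
import Summits.Ventures.FusionMHD.Bench.SAlphaS25W48A19Panels
import Summits.Ventures.FusionMHD.Bench.SAlphaS25W48A49Panels
import Literature.MathematicalPhysics.MHD.BallooningSAlphaWitnessInterval
import HarnessLib

/-!
# F3 — THE UNSTABLE BAND OF THE `s–α` MODEL AT SHEAR `s = 5/2`, CERTIFIED UP TO THE SECOND-STABILITY EDGE: `U_{5/2} ⊇ [19/10, 49/10]` — ONE
# finite-element trial function (window `[−6, 6]`, tuned at `α = 24/5`) is a witness at `α = 19/10` AND at `α = 49/10`, hence — the energy of a fixed
# trial function is a convex quadratic polynomial in `α` (`BallooningSAlphaWitnessInterval.unstableWitness_of_mem_Icc`) — at every `α` between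
(venture LADDER-GRIDFUSION, rung F3; cell `gridfusion`, typed by gridfusion-lit-3 (g14), 2026-08-28.  ONE composition file: 0 `def … : Prop` facts,
0 defs, 0 kit jobs, no `native_decide`, no floating point in any statement; 2 × 12 kernel panel enclosures in the panel files.)

## THREE COLUMNS
CERTIFIED (kernel): in the `s–α` ballooning MODEL (Freidberg (12.96)–(12.99), `Λ = sθ − α sin θ`, `θ₀ = 0`) at shear `s = 5/2`: for EVERY
`α ∈ [19/10, 49/10]` the explicit trial function `X = Spline.trialX (1/2) 1 SAlphaS25W48.pieces (−6)` (12 quintic pieces, `C²`, dofs in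
`2⁻²⁴ℤ`, `X(±6) = 0`) has NEGATIVE one-surface energy on `[−6, 6]` — `unstableWitness_19` (`W(19/10) ≈ −0.1610`), `unstableWitness_49`
(`W(49/10) ≈ −0.009691`; exact dyadic enclosures in `c19_seg_all` / `c49_seg_all`), then `unstableWitness_band` by convexity in `α`.  So
`U_{5/2} ⊇ [19/10, 49/10] = [1.9, 4.9]`: the band contains the `s = 5/2` chord `[11/5, 21/5]` of Fundamenski's cosine conic
(`BallooningSAlphaCosineTrialFunction.unstableWitness_cosine_of_neg`) and the top `lensHi (5/2) = 199/50` of model-7's two-turn lens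
(`Models/SAlphaTwoTurnLens`); its lower end sits above the first-edge bracket of record `[11/8, 13/8]` (★ #246), its upper end `0.007` below
the float second edge.  VALIDATED (not in the kernel): shooting edges `α₁(5/2) ≈ 1.486`, `α₂(5/2) ≈ 4.907`; the function's own float chord
`(1.82, 4.905)`.  PAIRING (not imported, not assumed): a certified STABLE point `(5/2, α⁺)` with `α⁺ > 49/10` would make `(49/10, α⁺)` a
certified bracket of the SECOND edge at `s = 5/2`; none is in the tree at the time of writing.  MODELLED: `s–α` model (large-aspect-ratio
shifted circles, high-`n` ballooning ordering, `θ₀ = 0`, ideal MHD); «unstable» = the model's one-surface functional (12.38)/(12.97) is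
negative on an explicit compactly supported differentiable trial function vanishing at the ends of its window (lit-3's witness class, Newcomb
sense); representation step (Connor–Hastie–Taylor 1979) quoted in `BallooningSAlpha.lean`, not typed; no device, no `β`-limit.  Citations:
Freidberg 2014 §12.3 (12.38)–(12.40), §12.6.2 (12.97) [Freidberg2014]; Mahboubi–Melquiond–Sibut-Pinote 2016 §3.2–3.3
[MahboubiMelquiondSibutpinote2016].
-/

open Literature.Analysis.ValidatedNumerics Literature.Analysis.ValidatedNumerics.PolyMP
open Literature.Analysis.ValidatedNumerics.NumericsMP Literature.Analysis.ValidatedNumerics.ExpPoly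
open Literature.MathematicalPhysics.MHD.Ballooning Literature.MathematicalPhysics.MHD.Ballooning.SAlpha
open Literature.MathematicalPhysics.MHD.Ballooning.SAlpha.Spline
open Set

namespace Summit.Ventures.FusionMHD.Bench.SAlphaS25W48

/-- THE GLUED SEGMENT at `α = 19/10` in summed form. [cite: MahboubiMelquiondSibutpinote2016, Sect. 3.3] -/
theorem c19_seg_all :
    FSegOK (splineDensity (5/2) (19/10) (-6) (1/2) 1 pieces) [1] (2 ^ 60) (panelLeft (1/2) 0) (panelLeft (1/2) 12) (-185677429954576384) (-185677429941993472) := by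
  have h := c19_seg
  norm_num at h
  exact h

/-- THE `[-6, 6]` TRIAL FUNCTION IS A WITNESS AT `(5/2, 19/10)`: `UnstableWitness 5/2 (19/10) (-6) 6 X X′`, `2⁶⁰·W ≤ -185677429941993472` (`W ≈ -0.1610`;
enclosure `[-0.1610495, -0.1610495]`). [cite: Freidberg2014, §12.3 eqs. (12.38)–(12.40)] -/
theorem unstableWitness_19 :
    UnstableWitness (5/2) (19/10) (-6) 6 (trialX (1/2) 1 pieces (-6)) (trialX' (1/2) 1 pieces (-6)) := by
  have h := unstableWitness_of_spline (s := 5/2) (α := 19/10) (a := -6) (h := 1/2) (m := 1) (ps := pieces)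
    (by norm_num : (0:ℚ) < 1/2) one_pos pieces_ne_nil pieces_match pieces_deriv_match head_zero last_zero c19_seg_all (by decide)
  rw [pieces_length] at h
  norm_num at h
  exact h

/-- THE GLUED SEGMENT at `α = 49/10` in summed form. [cite: MahboubiMelquiondSibutpinote2016, Sect. 3.3] -/
theorem c49_seg_all :
    FSegOK (splineDensity (5/2) (49/10) (-6) (1/2) 1 pieces) [1] (2 ^ 60) (panelLeft (1/2) 0) (panelLeft (1/2) 12) (-11173511213088768) (-11173511194214400) := by
  have h := c49_seg
  norm_num at h
  exact h

/-- THE `[-6, 6]` TRIAL FUNCTION IS A WITNESS AT `(5/2, 49/10)`: `UnstableWitness 5/2 (49/10) (-6) 6 X X′`, `2⁶⁰·W ≤ -11173511194214400` (`W ≈ -0.0097`;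
enclosure `[-0.0096915, -0.0096915]`). [cite: Freidberg2014, §12.3 eqs. (12.38)–(12.40)] -/
theorem unstableWitness_49 :
    UnstableWitness (5/2) (49/10) (-6) 6 (trialX (1/2) 1 pieces (-6)) (trialX' (1/2) 1 pieces (-6)) := by
  have h := unstableWitness_of_spline (s := 5/2) (α := 49/10) (a := -6) (h := 1/2) (m := 1) (ps := pieces)
    (by norm_num : (0:ℚ) < 1/2) one_pos pieces_ne_nil pieces_match pieces_deriv_match head_zero last_zero c49_seg_all (by decide)
  rw [pieces_length] at h
  norm_num at h
  exact h

/-- ★★ THE BAND: the `[-6, 6]` trial function is a witness at EVERY `α ∈ [19/10, 49/10]` (the energy of a fixed trial function is a convex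
quadratic polynomial in `α`): `U_{5/2} ⊇ [19/10, 49/10]`. [cite: Freidberg2014, §12.3 eqs. (12.38)–(12.40)] («… The plasma is unstable», for the band of the MODEL) -/
theorem unstableWitness_band :
    ∀ α ∈ Icc (19/10 : ℝ) (49/10), UnstableWitness (5/2) α (-6) 6 (trialX (1/2) 1 pieces (-6)) (trialX' (1/2) 1 pieces (-6)) :=
  unstableWitness_of_mem_Icc unstableWitness_19 unstableWitness_49

/-- … hence every point of the band carries SOME witness, [cite: Freidberg2014, §12.3 eqs. (12.38)–(12.40)] -/
theorem exists_unstableWitness_of_mem_band {α : ℝ} (hα : α ∈ Icc (19/10 : ℝ) (49/10)) :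
    ∃ a b : ℝ, ∃ X X' : ℝ → ℝ, UnstableWitness (5/2) α a b X X' :=
  ⟨_, _, _, _, unstableWitness_band α hα⟩

/-- … and none is on the stable side. [cite: Freidberg2014, §12.3 eq. (12.40)] -/
theorem not_stableSide_of_mem_band {α : ℝ} (hα : α ∈ Icc (19/10 : ℝ) (49/10)) : ¬ StableSide (5/2) α := by
  obtain ⟨a, b, X, X', hw⟩ := exists_unstableWitness_of_mem_band hα
  exact fun hs => hs a b X X' hw

end Summit.Ventures.FusionMHD.Bench.SAlphaS25W48
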